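import Summits.Ventures.PackingBounds.Configurations.CL17Codes

/-!
# Cohn–Li in dimension `17`, III: the five vector families, `480 + 3840 + 1024 + 2 + 384 = 5730`

Framing: lottery ticket; floor = certified bounds/negative ranges. Venture `PackingBounds` (cell
`pub-packcert`, seat `pub-packcert-energy`).

The integer model (scale `3`, `√2`-axis doubled, see `CL17Vectors.lean`) of the Cohn–Li `17`-dimensional kissing
configuration [Cohn–Li 2024, §3]:
* `setA`: `(±6) e_k + (±6) e_l`, `k < l < 16` (`4 · C(16,2) = 480`);
* `setB`: `±3` on a pair or square of `C₆` with an ODD number of minus signs (`30 · 2⁷ = 3840`);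
* `setX`: `±3` on a cross with an odd number of minus signs, `±3` on the axis (`16 · 2⁵ · 2 = 1024`);
* `setT`: `±6` on the axis (`2`);
* `setD`: `±2` on all cells with the signs of a word of `C⁺` (axis `+2`) or `C⁻` (axis `−2`) (`2 · 192 = 384`).
Sign patterns are indexed through the increasing enumerations `wpos`, `xpos` of the supports (the tree's
`bbitOdd` for `8` signs, `xbit` for `6`). This file proves the parametrisations injective and counts the five parts; disjointness and the total
`5730`, norms and the transfer to `ℝ¹⁷` are in `CL17.lean`, the pairwise inner products in `CL17Pairs.lean`.

## References
* H. Cohn, A. Li, *Improved kissing numbers in seventeen through twenty-one dimensions*, arXiv:2411.04916 (2024), §3. [`CohnLi2024`]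
-/

namespace Summit.Ventures.PackingBounds.Config.CL17

open Finset Leech Golay

/-! ### Six-sign odd patterns -/

/-- Number of set bits among the `5` free sign bits. -/
def cnt5 (v : ℕ) : ℕ := (univ.filter fun t : Fin 5 => v.testBit t.val = true).card

/-- The `6` sign bits of the odd pattern `v < 32`: bits `0..4` of `v` and the complemented parity bit. -/
def xbit (v : ℕ) (r : Fin 6) : Bool := if r.val < 5 then v.testBit r.val else !decide (cnt5 v % 2 = 1)

/-- A six-sign odd pattern has an odd number of minus signs. -/
theorem odd_card_xbit (v : ℕ) : Odd (univ.filter fun r : Fin 6 => xbit v r = true).card := by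
  rw [Finset.card_filter, Fin.sum_univ_castSucc]
  have h5 : ∑ t : Fin 5, (if xbit v t.castSucc = true then 1 else 0) = cnt5 v := by
    rw [cnt5, Finset.card_filter]
    refine Finset.sum_congr rfl fun t _ => ?_
    simp [xbit, t.isLt]
  rw [h5]
  have hl : xbit v (Fin.last 5) = !decide (cnt5 v % 2 = 1) := by simp [xbit]
  rw [hl]
  by_cases h : cnt5 v % 2 = 1
  · simp only [h, decide_true, Bool.not_true, Bool.false_eq_true, if_false, add_zero]; exact ⟨cnt5 v / 2, by omega⟩
  · simp only [h, decide_false, Bool.not_false, if_true]; exact ⟨cnt5 v / 2, by omega⟩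

/-- Six-sign odd patterns `v ≠ v' < 32` differ in some sign bit. -/
theorem xbit_ne_of_ne {v v' : ℕ} (hv : v < 32) (hv' : v' < 32) (h : v ≠ v') : ∃ r, xbit v r ≠ xbit v' r := by
  by_contra hall
  simp only [ne_eq, not_exists, Decidable.not_not] at hall
  apply h
  apply Nat.eq_of_testBit_eq
  intro t
  by_cases ht : t < 5
  · have := hall ⟨t, by omega⟩
    simpa [xbit, ht] using this
  · have h32 : 2 ^ 5 ≤ 2 ^ t := Nat.pow_le_pow_right (by norm_num) (by omega)
    rw [Nat.testBit_eq_false_of_lt (lt_of_lt_of_le hv h32),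
      Nat.testBit_eq_false_of_lt (lt_of_lt_of_le hv' h32)]

/-! ### Patterns placed on supports -/

/-- Increasing enumeration of the cells of the pair/square `i`. -/
def wpos (i : Fin 30) : Fin 8 ≃o supp (w8 i) := (supp (w8 i)).orderIsoOfFin (card_supp_w8 i)

/-- Increasing enumeration of the cells of the cross `i`. -/
def xpos (i : Fin 16) : Fin 6 ≃o supp (x6 i) := (supp (x6 i)).orderIsoOfFin (card_supp_x6 i)

/-- The odd `8`-sign pattern `v` placed on the cells of the pair/square `i` (`false` elsewhere). -/
def pat8 (i : Fin 30) (v : ℕ) : Fin 24 → Bool :=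
  fun j => if h : j ∈ supp (w8 i) then bbitOdd v ((wpos i).symm ⟨j, h⟩) else false

/-- The odd `6`-sign pattern `v` placed on the cells of the cross `i` (`false` elsewhere). -/
def pat6 (i : Fin 16) (v : ℕ) : Fin 24 → Bool :=
  fun j => if h : j ∈ supp (x6 i) then xbit v ((xpos i).symm ⟨j, h⟩) else false

/-- Values of `pat8` along the enumeration. -/
theorem pat8_apply_wpos (i : Fin 30) (v : ℕ) (r : Fin 8) : pat8 i v (wpos i r) = bbitOdd v r := by
  simp only [pat8, dif_pos (wpos i r).2, Subtype.coe_eta, OrderIso.symm_apply_apply]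

/-- Values of `pat6` along the enumeration. -/
theorem pat6_apply_xpos (i : Fin 16) (v : ℕ) (r : Fin 6) : pat6 i v (xpos i r) = xbit v r := by
  simp only [pat6, dif_pos (xpos i r).2, Subtype.coe_eta, OrderIso.symm_apply_apply]

/-- Counting positions with a property through an enumeration `Fin s ≃o S`. -/
theorem card_filter_orderIso {s : ℕ} {S : Finset (Fin 24)} (σ : Fin s ≃o S) (P : Fin 24 → Prop)
    [DecidablePred P] : (univ.filter fun r : Fin s => P (σ r)).card = (S.filter P).card := by
  rw [Finset.card_filter, Finset.card_filter, ← Finset.sum_coe_sort S]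
  exact Fintype.sum_equiv σ.toEquiv _ (fun j : S => if P j then 1 else 0) fun _ => rfl

/-- `pat8 i v` has an odd number of minus signs on its support. -/
theorem odd_card_pat8 (i : Fin 30) (v : ℕ) : Odd ((supp (w8 i)).filter fun j => pat8 i v j = true).card := by
  rw [← card_filter_orderIso (wpos i) (fun j => pat8 i v j = true)]
  simp only [pat8_apply_wpos]
  exact odd_card_bbitOdd v

/-- `pat6 i v` has an odd number of minus signs on its support. -/
theorem odd_card_pat6 (i : Fin 16) (v : ℕ) : Odd ((supp (x6 i)).filter fun j => pat6 i v j = true).card := by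
  rw [← card_filter_orderIso (xpos i) (fun j => pat6 i v j = true)]
  simp only [pat6_apply_xpos]
  exact odd_card_xbit v

/-- `pat8 i` is injective on `v < 128` (as a function on the support). -/
theorem pat8_inj {i : Fin 30} {v v' : ℕ} (hv : v < 128) (hv' : v' < 128)
    (h : ∀ j ∈ supp (w8 i), pat8 i v j = pat8 i v' j) : v = v' := by
  by_contra hne
  obtain ⟨r, hr⟩ := bbitOdd_ne_of_ne hv hv' hne
  exact hr (by rw [← pat8_apply_wpos, ← pat8_apply_wpos]; exact h _ (wpos i r).2)

/-- `pat6 i` is injective on `v < 32` (as a function on the support). -/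
theorem pat6_inj {i : Fin 16} {v v' : ℕ} (hv : v < 32) (hv' : v' < 32)
    (h : ∀ j ∈ supp (x6 i), pat6 i v j = pat6 i v' j) : v = v' := by
  by_contra hne
  obtain ⟨r, hr⟩ := xbit_ne_of_ne hv hv' hne
  exact hr (by rw [← pat6_apply_xpos, ← pat6_apply_xpos]; exact h _ (xpos i r).2)

/-! ### Generic injectivity of pattern vectors -/

/-- Equal pattern vectors on the same support (`a ≠ 0`) have the same signs on the support and the same axis
value. -/
theorem pvec_eq_pvec {S : Finset (Fin 24)} (hS : S ⊆ cells) {f f' : Fin 24 → Bool} {a e e' : ℤ} (ha : a ≠ 0)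
    (h : pvec S f a e = pvec S f' a e') : (∀ j ∈ S, f j = f' j) ∧ e = e' := by
  refine ⟨fun j hj => ?_, ?_⟩
  · have hc := congrFun h j
    have hjl := mem_cells.mp (hS hj)
    rw [pvec_apply_of_lt S f a e hjl, pvec_apply_of_lt S f' a e' hjl, if_pos hj, if_pos hj] at hc
    exact sgn_injective (mul_left_cancel₀ ha hc)
  · have hc := congrFun h 16
    rwa [pvec_apply_16 hS, pvec_apply_16 hS] at hc

/-- The nonzero cells of a pattern vector with `a ≠ 0` form its support. -/
theorem nz_pvec_eq {S : Finset (Fin 24)} (hS : S ⊆ cells) (f : Fin 24 → Bool) {a : ℤ} (ha : a ≠ 0) (e : ℤ) :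
    (cells.filter fun j => pvec S f a e j ≠ 0) = S := by
  ext j
  simp only [Finset.mem_filter, mem_cells]
  constructor
  · rintro ⟨hj, hne⟩
    rw [pvec_apply_of_lt S f a e hj] at hne
    by_contra h; exact hne (by rw [if_neg h])
  · intro hj
    have hjl := mem_cells.mp (hS hj)
    refine ⟨hjl, ?_⟩
    rw [pvec_apply_of_lt S f a e hjl, if_pos hj]
    rcases sgn_cases (f j) with h1 | h1 <;> simp [h1, ha]

/-- The number of nonzero cells of a pattern vector with `a ≠ 0` is the size of its support. -/
theorem card_nz_pvec {S : Finset (Fin 24)} (hS : S ⊆ cells) (f : Fin 24 → Bool) {a : ℤ} (ha : a ≠ 0) (e : ℤ) :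
    (cells.filter fun j => pvec S f a e j ≠ 0).card = S.card := by
  rw [nz_pvec_eq hS f ha e]

/-! ### The five parts -/

/-- Shape `A` as a pattern vector: `(±6) e_k + (±6) e_l`. [cite: CohnLi2024, §3] -/
def aV (k l : Fin 24) (a b : Bool) : Fin 24 → ℤ := pvec {k, l} (fun j => if j = k then a else b) 6 0

/-- Index set of shape `A`: cells `k < l`. -/
def idxA : Finset (Fin 24 × Fin 24) := (univ ×ˢ univ).filter fun q => q.1 < q.2 ∧ q.2.val < 16

/-- Shape `A`: `480` vectors. -/
def setA : Finset (Fin 24 → ℤ) :=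
  (idxA ×ˢ (univ : Finset (Bool × Bool))).image fun q => aV q.1.1 q.1.2 q.2.1 q.2.2

/-- Shape `B`: odd `±3` patterns on the pairs and squares, `3840` vectors. [cite: CohnLi2024, §3] -/
def setB : Finset (Fin 24 → ℤ) :=
  ((univ : Finset (Fin 30)) ×ˢ range 128).image fun q => pvec (supp (w8 q.1)) (pat8 q.1 q.2) 3 0

/-- Shape `X`: odd `±3` patterns on the crosses with `±3` on the axis, `1024` vectors. [cite: CohnLi2024, §3] -/
def setX : Finset (Fin 24 → ℤ) :=
  (((univ : Finset (Fin 16)) ×ˢ range 32) ×ˢ (univ : Finset Bool)).image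
    fun q => pvec (supp (x6 q.1.1)) (pat6 q.1.1 q.1.2) 3 (3 * sgn q.2)

/-- Shape `T`: `±6` on the axis, `2` vectors. [cite: CohnLi2024, §3] -/
def setT : Finset (Fin 24 → ℤ) := (univ : Finset Bool).image fun c => pvec ∅ (fun _ => false) 0 (6 * sgn c)

/-- Shape `D` (the added deep holes): signs of `C⁺` with axis `+2`, of `C⁻` with axis `−2`, `384` vectors.
[cite: CohnLi2024, §3] -/
def setD : Finset (Fin 24 → ℤ) :=
  (range 12 ×ˢ range 32).image fun q => pvec cells (fun j => (cd q.1 q.2).testBit j.val) 2 (2 * sgn (decide (6 ≤ q.1)))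

/-- **The Cohn–Li `17`-dimensional configuration, integer model** (`5730` vectors of norm `72` in `ℤ²⁴`).
[cite: CohnLi2024, Thm. 1.1, §3] -/
def cl17Int : Finset (Fin 24 → ℤ) := setA ∪ setB ∪ setX ∪ setT ∪ setD

attribute [irreducible] idxA setA setB setX setT setD cl17Int

/-! ### Membership -/

/-- Members of `A`. -/
theorem mem_setA {x : Fin 24 → ℤ} :
    x ∈ setA ↔ ∃ k l : Fin 24, ∃ a b : Bool, (k < l ∧ l.val < 16) ∧ x = aV k l a b := by
  simp only [setA, idxA, mem_image, mem_product, mem_filter, mem_univ, true_and, and_true, Prod.exists]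
  constructor
  · rintro ⟨k, l, a, b, hkl, rfl⟩; exact ⟨k, l, a, b, hkl, rfl⟩
  · rintro ⟨k, l, a, b, hkl, rfl⟩; exact ⟨k, l, a, b, hkl, rfl⟩

/-- Members of `B`. -/
theorem mem_setB {x : Fin 24 → ℤ} :
    x ∈ setB ↔ ∃ i : Fin 30, ∃ v < 128, x = pvec (supp (w8 i)) (pat8 i v) 3 0 := by
  simp only [setB, mem_image, mem_product, mem_univ, mem_range, true_and, Prod.exists]
  constructor
  · rintro ⟨i, v, hv, rfl⟩; exact ⟨i, v, hv, rfl⟩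
  · rintro ⟨i, v, hv, rfl⟩; exact ⟨i, v, hv, rfl⟩

/-- Members of `X`. -/
theorem mem_setX {x : Fin 24 → ℤ} :
    x ∈ setX ↔ ∃ i : Fin 16, ∃ v < 32, ∃ c : Bool, x = pvec (supp (x6 i)) (pat6 i v) 3 (3 * sgn c) := by
  simp only [setX, mem_image, mem_product, mem_univ, mem_range, true_and, and_true, Prod.exists]
  constructor
  · rintro ⟨i, v, c, hv, rfl⟩; exact ⟨i, v, hv, c, rfl⟩
  · rintro ⟨i, v, hv, c, rfl⟩; exact ⟨i, v, c, hv, rfl⟩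

/-- Members of `T`. -/
theorem mem_setT {x : Fin 24 → ℤ} : x ∈ setT ↔ ∃ c : Bool, x = pvec ∅ (fun _ => false) 0 (6 * sgn c) := by
  simp only [setT, mem_image, mem_univ, true_and]
  constructor
  · rintro ⟨c, rfl⟩; exact ⟨c, rfl⟩
  · rintro ⟨c, rfl⟩; exact ⟨c, rfl⟩

/-- Members of `D`. -/
theorem mem_setD {x : Fin 24 → ℤ} : x ∈ setD ↔
    ∃ p < 12, ∃ m < 32, x = pvec cells (fun j => (cd p m).testBit j.val) 2 (2 * sgn (decide (6 ≤ p))) := by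
  simp only [setD, mem_image, mem_product, mem_range, Prod.exists]
  constructor
  · rintro ⟨p, m, ⟨hp, hm⟩, rfl⟩; exact ⟨p, hp, m, hm, rfl⟩
  · rintro ⟨p, hp, m, hm, rfl⟩; exact ⟨p, m, ⟨hp, hm⟩, rfl⟩

/-- Members of the whole configuration. -/
theorem mem_cl17Int {x : Fin 24 → ℤ} (hx : x ∈ cl17Int) :
    x ∈ setA ∨ x ∈ setB ∨ x ∈ setX ∨ x ∈ setT ∨ x ∈ setD := by
  rw [cl17Int] at hx
  simp only [mem_union] at hx
  tauto

/-! ### Supports are cells -/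

/-- The support of a pair/square consists of cells. -/
theorem supp_w8_sub (i : Fin 30) : supp (w8 i) ⊆ cells := fun j hj => mem_cells.mpr (supp_w8_lt i.isLt j hj)

/-- The support of a cross consists of cells. -/
theorem supp_x6_sub (i : Fin 16) : supp (x6 i) ⊆ cells := fun j hj => mem_cells.mpr (supp_x6_lt i.isLt j hj)

/-- A two-cell set consists of cells. -/
theorem pair_sub {k l : Fin 24} (hk : k.val < 16) (hl : l.val < 16) : ({k, l} : Finset (Fin 24)) ⊆ cells := by
  intro j hj
  rw [Finset.mem_insert, Finset.mem_singleton] at hj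
  rcases hj with rfl | rfl <;> exact mem_cells.mpr ‹_›

/-! ### Cardinalities -/

/-- `|idxA| = C(16,2) = 120`. -/
theorem card_idxA : idxA.card = 120 := by
  rw [idxA]; decide +kernel

/-- `|A| = 480`. -/
theorem card_setA : setA.card = 480 := by
  rw [setA, card_image_of_injOn, card_product, card_idxA]
  · simp
  rintro ⟨⟨k, l⟩, ⟨a, b⟩⟩ hq ⟨⟨k', l'⟩, ⟨a', b'⟩⟩ hq' h
  simp only [coe_product, Set.mem_prod, mem_coe, idxA, mem_filter, mem_product, mem_univ, true_and, and_true]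
    at hq hq'
  obtain ⟨hkl, hl⟩ := hq
  obtain ⟨hkl', hl'⟩ := hq'
  have hk : k.val < 16 := lt_trans hkl hl
  have hk' : k'.val < 16 := lt_trans hkl' hl'
  change aV k l a b = aV k' l' a' b' at h
  unfold aV at h
  have h6 : (6 : ℤ) ≠ 0 := by norm_num
  have hsupp : ({k, l} : Finset (Fin 24)) = {k', l'} := by
    rw [← nz_pvec_eq (pair_sub hk hl) (fun j => if j = k then a else b) h6 0,
      ← nz_pvec_eq (pair_sub hk' hl') (fun j => if j = k' then a' else b') h6 0, h]
  have h1 : k = k' ∨ k = l' := by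
    have : k ∈ ({k', l'} : Finset (Fin 24)) := by rw [← hsupp]; simp
    simpa using this
  have h2 : l = k' ∨ l = l' := by
    have : l ∈ ({k', l'} : Finset (Fin 24)) := by rw [← hsupp]; simp
    simpa using this
  have hkk : k = k' ∧ l = l' := by
    simp only [Fin.ext_iff, Fin.lt_def] at h1 h2 hkl hkl' ⊢
    omega
  obtain ⟨rfl, rfl⟩ := hkk
  have hne : k ≠ l := ne_of_lt hkl
  obtain ⟨hf, -⟩ := pvec_eq_pvec (pair_sub hk hl) h6 h
  have ha := hf k (by simp)
  have hb := hf l (by simp)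
  simp only [if_true, if_neg hne.symm] at ha hb
  subst ha hb; rfl

/-- `|B| = 3840`. -/
theorem card_setB : setB.card = 3840 := by
  rw [setB, card_image_of_injOn]
  · simp
  rintro ⟨i, v⟩ hq ⟨i', v'⟩ hq' h
  simp only [coe_product, Set.mem_prod, mem_coe, mem_univ, mem_range, true_and] at hq hq'
  change pvec (supp (w8 i)) (pat8 i v) 3 0 = pvec (supp (w8 i')) (pat8 i' v') 3 0 at h
  have h3 : (3 : ℤ) ≠ 0 := by norm_num
  have hsupp : supp (w8 i) = supp (w8 i') := by
    rw [← nz_pvec_eq (supp_w8_sub i) (pat8 i v) h3 0, ← nz_pvec_eq (supp_w8_sub i') (pat8 i' v') h3 0, h]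
  have hii : i = i' := Fin.ext (w8_inj i.isLt i'.isLt hsupp)
  subst hii
  obtain ⟨hf, -⟩ := pvec_eq_pvec (supp_w8_sub i) h3 h
  rw [pat8_inj hq hq' hf]

set_option maxRecDepth 100000 in
/-- `|X| = 1024`. -/
theorem card_setX : setX.card = 1024 := by
  rw [setX, card_image_of_injOn]
  · simp
  rintro ⟨⟨i, v⟩, c⟩ hq ⟨⟨i', v'⟩, c'⟩ hq' h
  simp only [coe_product, Set.mem_prod, mem_coe, mem_univ, mem_range, true_and, and_true] at hq hq'
  change pvec (supp (x6 i)) (pat6 i v) 3 (3 * sgn c) = pvec (supp (x6 i')) (pat6 i' v') 3 (3 * sgn c') at h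
  have h3 : (3 : ℤ) ≠ 0 := by norm_num
  have hsupp : supp (x6 i) = supp (x6 i') := by
    rw [← nz_pvec_eq (supp_x6_sub i) (pat6 i v) h3 (3 * sgn c),
      ← nz_pvec_eq (supp_x6_sub i') (pat6 i' v') h3 (3 * sgn c'), h]
  have hii : i = i' := Fin.ext (x6_inj i.isLt i'.isLt hsupp)
  subst hii
  obtain ⟨hf, he⟩ := pvec_eq_pvec (supp_x6_sub i) h3 h
  have hc : c = c' := sgn_injective (by omega)
  subst hc
  rw [pat6_inj hq hq' hf]

/-- `|T| = 2`. -/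
theorem card_setT : setT.card = 2 := by
  rw [setT, card_image_of_injective]
  · simp
  intro c c' h
  change pvec ∅ (fun _ => false) 0 (6 * sgn c) = pvec ∅ (fun _ => false) 0 (6 * sgn c') at h
  have hc := congrFun h 16
  rw [pvec_apply_16 (Finset.empty_subset _), pvec_apply_16 (Finset.empty_subset _)] at hc
  exact sgn_injective (by omega)

/-- `|D| = 384`. -/
theorem card_setD : setD.card = 384 := by
  rw [setD, card_image_of_injOn]
  · simp
  rintro ⟨p, m⟩ hq ⟨p', m'⟩ hq' h
  simp only [coe_product, Set.mem_prod, mem_coe, mem_range] at hq hq'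
  change pvec cells (fun j => (cd p m).testBit j.val) 2 (2 * sgn (decide (6 ≤ p))) =
    pvec cells (fun j => (cd p' m').testBit j.val) 2 (2 * sgn (decide (6 ≤ p'))) at h
  by_contra hne
  have hne' : ¬ (p = p' ∧ m = m') := fun ⟨h1, h2⟩ => hne (by rw [h1, h2])
  obtain ⟨hf, -⟩ := pvec_eq_pvec subset_rfl (by norm_num : (2 : ℤ) ≠ 0) h
  have h0 : wtK 16 (cd p m ^^^ cd p' m') = 0 := by
    rw [← card_cells_filter_xor, Finset.inter_self, Finset.card_eq_zero, Finset.filter_eq_empty_iff]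
    intro j hj
    rw [hf j hj]; simp
  have h4 := (wtK_cd_xor hq.1 hq'.1 hq.2 hq'.2 hne').2
  omega

end Summit.Ventures.PackingBounds.Config.CL17
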